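import Literature.NumberTheory.Sieve.PolymathGEHWindowGEH
import Literature.NumberTheory.Sieve.PolymathGEHTypeI
import Literature.NumberTheory.Sieve.ElliottHalberstamBridgeProofs
import HarnessLib

/-!
# Proposition 2.7 (`GEH ⟹ EH`): the window form of `EH[ϑ]` from `GEH[ϑ]`

Trunk AntSieve, tooling toward the named fact `Literature.NumberTheory.Sieve.weakDHL_three_two_of_GEH`
(D. H. J. Polymath, Res. Math. Sci. 1:12 (2014) = arXiv:1407.4897, Theorem 3.2(xii)).  Assembly of
the files `PolymathGEHWindowDecomp`, `-Pieces`, `-Straddle`, `-GEH` and `PolymathGEHTypeI` into the window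
estimate

  `Σ_{q ≤ X^ϑ} sup_a |Δ(Λ; ⌊X⌋; a (q)) − Δ(Λ; ⌊X/2⌋; a (q))| ≤ C X (log X)^{-A}`   (`ehWindow_of_geh`)

for every `0 < ϑ < 1` with `GEH[ϑ]` and every `A > 0`: Vaughan's identity with `U = V = X^{(1−ϑ)/4}`,
Type I terms by the interleaving bound, Type II pieces inside the window by `GEH[ϑ]` (family of
`PolymathGEHWindowGEH`), straddling pieces by `GEH[ϑ]` for the majorant plus the `ℓ¹` bound of
`PolymathGEHWindowStraddle` with `ρ − 1 = (log X)^{−A−5}`.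

## References

* [Polymath8b2014] D. H. J. Polymath, Res. Math. Sci. 1 (2014), Art. 12 = arXiv:1407.4897,
  Claim 2.6, Proposition 2.7 (pp. 6–7).
-/

noncomputable section

open Finset Real Filter
open scoped ArithmeticFunction.Moebius ArithmeticFunction.vonMangoldt ArithmeticFunction.zeta
  ArithmeticFunction.sigma

namespace Literature.NumberTheory.Sieve

open BFI (absAF absAF_apply)

namespace GEHtoEH

variable {ε₁ B₀ X : ℝ}

/-! ### Pieces that are not relevant contribute nothing -/

/-- A dead `α`-piece: if `⌊ρ^{s+1}⌋ ≤ U` then `α_s = 0`. [folklore] -/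
theorem alphaPiece_eq_zero_of_le {U : ℕ} {ρ : ℝ} {s : ℕ} (h : lo ρ (s + 1) ≤ U) : alphaPiece U ρ s = 0 := by
  ext n
  rw [alphaPiece_apply, ArithmeticFunction.zero_apply]
  split_ifs with hn
  · exact aFun_eq_zero (hn.2.trans h)
  · rfl

/-- A dead `β`-piece: if `⌊ρ^{t+1}⌋ ≤ V` then `β_t = 0`. [folklore] -/
theorem betaPiece_eq_zero_of_le {V : ℕ} {ρ : ℝ} {t : ℕ} (h : lo ρ (t + 1) ≤ V) : betaPiece V ρ t = 0 := by
  ext c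
  rw [betaPiece_apply, ArithmeticFunction.zero_apply, if_neg]
  rintro ⟨h1, h2⟩
  have := le_max_left V (lo ρ t)
  omega

/-- **Only relevant pairs contribute** (for `X ≥ 16`, `X^{ε₁/2} ≥ 4`): if `(s, t)` is not relevant,
the window discrepancy of `α_s ⋆ β_t` vanishes. [folklore] -/
theorem windowDisc_eq_zero_of_not_relevant (hX : 16 ≤ X) (hE : 4 ≤ X ^ (ε₁ / 2)) {s t : ℕ}
    (h : ¬ Relevant ε₁ B₀ X s t) (q : ℕ) (a : (ZMod q)ˣ) :
    windowDisc (fun n => (alphaPiece (Ucut ε₁ X) (rho B₀ X) s * betaPiece (Ucut ε₁ X) (rho B₀ X) t) n)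
      ⌊X / 2⌋₊ ⌊X⌋₊ q a = 0 := by
  have h01 : ⌊X / 2⌋₊ ≤ ⌊X⌋₊ := Nat.floor_le_floor (by linarith)
  have hzero : ∀ γ : ArithmeticFunction ℝ, γ = 0 →
      windowDisc (fun n => γ n) ⌊X / 2⌋₊ ⌊X⌋₊ q a = 0 := by
    rintro γ rfl
    unfold windowDisc
    simp only [ArithmeticFunction.zero_apply]
    rw [apDiscrepancy_zero, apDiscrepancy_zero, sub_zero]
  by_cases c1 : Ucut ε₁ X < lo (rho B₀ X) (s + 1)
  swap
  · exact hzero _ (by rw [alphaPiece_eq_zero_of_le (not_lt.1 c1), zero_mul])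
  by_cases c2 : Ucut ε₁ X < lo (rho B₀ X) (t + 1)
  swap
  · exact hzero _ (by rw [betaPiece_eq_zero_of_le (not_lt.1 c2), mul_zero])
  have c5 := lo_succ_le_two_mul_of_Ucut_lt (B₀ := B₀) hX hE c1
  have c6 := lo_succ_le_two_mul_of_Ucut_lt (B₀ := B₀) hX hE c2
  by_cases c3 : (lo (rho B₀ X) s + 1) * (mV (Ucut ε₁ X) (rho B₀ X) t + 1) ≤ ⌊X⌋₊
  swap
  · exact windowDisc_eq_zero_of_high _ _ _ s t h01 (not_le.1 c3) q a
  by_cases c4 : ⌊X / 2⌋₊ < lo (rho B₀ X) (s + 1) * lo (rho B₀ X) (t + 1)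
  swap
  · exact windowDisc_eq_zero_of_low _ _ _ s t h01 (not_lt.1 c4) q a
  exact absurd ⟨c1, c2, c3, c4, c5, c6⟩ h

/-! ### The bound for one relevant pair -/

/-- The piece `γ_{s,t} = α_s ⋆ β_t` as a sequence. [folklore] -/
def pieceγ (ε₁ B₀ X : ℝ) (s t : ℕ) : ℕ → ℝ :=
  fun n => (alphaPiece (Ucut ε₁ X) (rho B₀ X) s * betaPiece (Ucut ε₁ X) (rho B₀ X) t) n

/-- Its nonnegative majorant `G_{s,t} = |α_s| ⋆ β_t` as a sequence. [folklore] -/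
def pieceG (ε₁ B₀ X : ℝ) (s t : ℕ) : ℕ → ℝ :=
  fun n => (absAF (alphaPiece (Ucut ε₁ X) (rho B₀ X) s) * betaPiece (Ucut ε₁ X) (rho B₀ X) t) n

/-- The `GEH` cut-off of the pair, `⌊2·2·(⌊ρ^s⌋ m_t)⌋`. [folklore] -/
def cutN (ε₁ B₀ X : ℝ) (s t : ℕ) : ℕ :=
  ⌊(2 : ℝ) * 2 * ((lo (rho B₀ X) s : ℝ) * (mV (Ucut ε₁ X) (rho B₀ X) t : ℝ))⌋₊

/-- The `ℓ¹` mass `‖α_s‖₁ ‖β_t‖₁` of the pair. [folklore] -/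
def l1mass (ε₁ B₀ X : ℝ) (s t : ℕ) : ℝ :=
  (∑ m ∈ Ioc (lo (rho B₀ X) s) (lo (rho B₀ X) (s + 1)), |aFun (Ucut ε₁ X) m|) *
    ∑ c ∈ Ioc (mV (Ucut ε₁ X) (rho B₀ X) t) (lo (rho B₀ X) (t + 1)), (Λ c : ℝ)

/-- The supremum over primitive classes of `|Δ(γ; N; a (q))|`. [folklore] -/
def supDisc (γ : ℕ → ℝ) (N q : ℕ) : ℝ := ⨆ b : (ZMod q)ˣ, |apDiscrepancy γ N q b|

/-- The `ℓ¹` mass is nonnegative. [folklore] -/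
theorem l1mass_nonneg (ε₁ B₀ X : ℝ) (s t : ℕ) : 0 ≤ l1mass ε₁ B₀ X s t :=
  mul_nonneg (Finset.sum_nonneg fun _ _ => abs_nonneg _)
    (Finset.sum_nonneg fun _ _ => ArithmeticFunction.vonMangoldt_nonneg)

/-- The supremum over primitive classes dominates each class. [folklore] -/
theorem le_supDisc (γ : ℕ → ℝ) (N : ℕ) {q : ℕ} (a : (ZMod q)ˣ) : |apDiscrepancy γ N q a| ≤ supDisc γ N q :=
  le_ciSup (Set.finite_range fun b : (ZMod q)ˣ => |apDiscrepancy γ N q b|).bddAbove a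

/-- The supremum of absolute discrepancies is nonnegative. [folklore] -/
theorem supDisc_nonneg (γ : ℕ → ℝ) (N q : ℕ) : 0 ≤ supDisc γ N q :=
  Real.iSup_nonneg fun _ => abs_nonneg _

/-- `cutN = 4 ⌊ρ^s⌋ m_t`. [folklore] -/
theorem cutN_eq (ε₁ B₀ X : ℝ) (s t : ℕ) :
    cutN ε₁ B₀ X s t = 4 * (lo (rho B₀ X) s * mV (Ucut ε₁ X) (rho B₀ X) t) := by
  unfold cutN
  have : (2 : ℝ) * 2 * ((lo (rho B₀ X) s : ℝ) * (mV (Ucut ε₁ X) (rho B₀ X) t : ℝ)) =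
      ((4 * (lo (rho B₀ X) s * mV (Ucut ε₁ X) (rho B₀ X) t) : ℕ) : ℝ) := by
    push_cast; ring
  rw [this, Nat.floor_natCast]

/-- For a relevant pair the product range ends below the `GEH` cut-off. [folklore] -/
theorem Relevant.hi_le_cutN {s t : ℕ} (h : Relevant ε₁ B₀ X s t) :
    lo (rho B₀ X) (s + 1) * lo (rho B₀ X) (t + 1) ≤ cutN ε₁ B₀ X s t := by
  rw [cutN_eq]
  obtain ⟨-, -, -, -, h5, h6⟩ := h
  have h6' : lo (rho B₀ X) (t + 1) ≤ 2 * mV (Ucut ε₁ X) (rho B₀ X) t :=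
    h6.trans (Nat.mul_le_mul_left 2 (le_max_right _ _))
  calc lo (rho B₀ X) (s + 1) * lo (rho B₀ X) (t + 1) ≤ (2 * lo (rho B₀ X) s) * (2 * mV (Ucut ε₁ X) (rho B₀ X) t) :=
        Nat.mul_le_mul h5 h6'
    _ = 4 * (lo (rho B₀ X) s * mV (Ucut ε₁ X) (rho B₀ X) t) := by ring

/-- The product range of the pair lies inside the window. [folklore] -/
def Inside (ε₁ B₀ X : ℝ) (s t : ℕ) : Prop :=
  ⌊X / 2⌋₊ < (lo (rho B₀ X) s + 1) * (mV (Ucut ε₁ X) (rho B₀ X) t + 1) ∧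
    lo (rho B₀ X) (s + 1) * lo (rho B₀ X) (t + 1) ≤ ⌊X⌋₊

/-- Being inside is decidable. [folklore] -/
instance (ε₁ B₀ X : ℝ) (s t : ℕ) : Decidable (Inside ε₁ B₀ X s t) := by unfold Inside; infer_instance

/-- A relevant pair that is not inside straddles an end of the window. [folklore] -/
theorem mem_straddleSet_of_relevant_not_inside {S s t : ℕ} (hs : s < S + 1) (ht : t < S + 1)
    (h : Relevant ε₁ B₀ X s t) (hni : ¬ Inside ε₁ B₀ X s t) :
    (s, t) ∈ straddleSet (Ucut ε₁ X) (rho B₀ X) S ⌊X / 2⌋₊ ⌊X⌋₊ := by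
  rw [straddleSet, Finset.mem_filter, Finset.mem_product, Finset.mem_range, Finset.mem_range]
  refine ⟨⟨hs, ht⟩, ?_⟩
  obtain ⟨-, -, h3, h4, -, -⟩ := h
  unfold Inside at hni
  rw [not_and_or, not_lt, not_le] at hni
  rcases hni with hni | hni
  · exact Or.inl ⟨hni, h4⟩
  · exact Or.inr ⟨h3, hni⟩

/-- **One relevant pair, inside**: `|Δ_W(γ_{s,t})| ≤ sup_a |Δ(γ_{s,t}; N')|`. [cite: Polymath8b2014, Proposition 2.7] -/
theorem abs_windowDisc_le_of_inside {s t : ℕ} (h : Relevant ε₁ B₀ X s t) (hin : Inside ε₁ B₀ X s t)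
    (q : ℕ) (a : (ZMod q)ˣ) :
    |windowDisc (pieceγ ε₁ B₀ X s t) ⌊X / 2⌋₊ ⌊X⌋₊ q a| ≤ supDisc (pieceγ ε₁ B₀ X s t) (cutN ε₁ B₀ X s t) q := by
  have e := windowDisc_eq_of_inside (Ucut ε₁ X) (Ucut ε₁ X) (rho B₀ X) s t hin.1 hin.2 h.hi_le_cutN q a
  unfold pieceγ
  rw [e]
  exact le_supDisc _ _ a

/-- **One relevant pair, straddling**: `|Δ_W(γ_{s,t})| ≤ 2 sup_a |Δ(G_{s,t}; N')| + (4/φ(q)) ‖α_s‖₁‖β_t‖₁`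
(`q ≥ 1`). [cite: Polymath8b2014, Proposition 2.7] -/
theorem abs_windowDisc_le_of_not_inside {s t : ℕ} (h : Relevant ε₁ B₀ X s t) {q : ℕ} (hq : 1 ≤ q)
    (a : (ZMod q)ˣ) :
    |windowDisc (pieceγ ε₁ B₀ X s t) ⌊X / 2⌋₊ ⌊X⌋₊ q a| ≤
      2 * supDisc (pieceG ε₁ B₀ X s t) (cutN ε₁ B₀ X s t) q + 4 / (Nat.totient q : ℝ) * l1mass ε₁ B₀ X s t := by
  have e := abs_windowDisc_le_of_straddle (Ucut ε₁ X) (Ucut ε₁ X) (rho B₀ X) s t ⌊X / 2⌋₊ ⌊X⌋₊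
    h.hi_le_cutN hq a
  unfold pieceγ
  refine e.trans (add_le_add ?_ ?_)
  · refine mul_le_mul_of_nonneg_left ?_ (by norm_num)
    exact (le_abs_self _).trans (le_supDisc (pieceG ε₁ B₀ X s t) _ a)
  · have hφ : (0 : ℝ) < Nat.totient q := by exact_mod_cast Nat.totient_pos.2 (by omega)
    exact mul_le_mul_of_nonneg_left (sum_absPieceMul_le _ _ _ s t _) (by positivity)

/-! ### The Type I terms -/

/-- `log` (as an arithmetic function) is monotone and nonnegative on `ℕ`. [folklore] -/
theorem log_monotone : Monotone (fun n : ℕ => (ArithmeticFunction.log n : ℝ)) := by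
  intro m n hmn
  simp only [ArithmeticFunction.log_apply]
  rcases Nat.eq_zero_or_pos m with rfl | hm
  · rw [Nat.cast_zero, Real.log_zero]; exact Real.log_natCast_nonneg n
  · exact Real.log_le_log (by exact_mod_cast hm) (by exact_mod_cast hmn)

/-- `ζ` (as a real arithmetic function) is monotone. [folklore] -/
theorem zeta_monotone : Monotone (fun n : ℕ => ((ζ : ArithmeticFunction ℝ) n : ℝ)) := by
  intro m n hmn
  simp only [ArithmeticFunction.natCoe_apply, ArithmeticFunction.zeta_apply]
  by_cases hm : m = 0
  · subst hm
    by_cases hn : n = 0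
    · subst hn; exact le_rfl
    · simp [hn]
  · have hn : n ≠ 0 := by omega
    simp [hm, hn]

/-- **Type I term `μ_{≤U} ⋆ log`**: `|Δ(μ_{≤U} ⋆ log; N)| ≤ 2 U log N` (`q ≥ 1`). [cite: Polymath8b2014, Proposition 2.7] -/
theorem abs_apDiscrepancy_typeI₁_le (U N : ℕ) {q : ℕ} (hq : 1 ≤ q) (a : (ZMod q)ˣ) :
    |apDiscrepancy (fun n => ((moebiusTrunc U : ArithmeticFunction ℝ) * ArithmeticFunction.log) n) N q a| ≤
      2 * Real.log N * U := by
  have h := typeI_apDiscrepancy_le (moebiusTrunc U : ArithmeticFunction ℝ) ArithmeticFunction.log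
    log_monotone (fun n => by rw [ArithmeticFunction.log_apply]; exact Real.log_natCast_nonneg n) hq a N
  refine h.trans ?_
  rw [ArithmeticFunction.log_apply]
  refine mul_le_mul_of_nonneg_left ?_ (by positivity)
  -- `Σ_{d ≤ N} |μ_{≤U}(d)| ≤ #[1, U] = U`
  calc ∑ d ∈ Icc 1 N, |((moebiusTrunc U : ArithmeticFunction ℝ)) d|
      ≤ ∑ d ∈ Icc 1 N, (if d ≤ U then (1 : ℝ) else 0) := by
        refine Finset.sum_le_sum fun d _ => ?_
        simp only [ArithmeticFunction.intCoe_apply, moebiusTrunc_apply]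
        split_ifs
        · exact_mod_cast ArithmeticFunction.abs_moebius_le_one
        · simp
    _ = #((Icc 1 N).filter fun d => d ≤ U) := by rw [← Finset.sum_filter]; simp
    _ ≤ #(Icc 1 U) := by
        refine Nat.cast_le.2 (Finset.card_le_card fun d hd => ?_)
        rw [Finset.mem_filter, Finset.mem_Icc] at hd
        rw [Finset.mem_Icc]; omega
    _ = U := by simp

/-- **Type I term `μ_{≤U} ⋆ Λ_{≤V} ⋆ 1`**: `|Δ(μ_{≤U} ⋆ Λ_{≤V} ⋆ 1; N)| ≤ 2 U ψ(V)` (`q ≥ 1`).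
[cite: Polymath8b2014, Proposition 2.7] -/
theorem abs_apDiscrepancy_typeI₂_le (U V N : ℕ) {q : ℕ} (hq : 1 ≤ q) (a : (ZMod q)ˣ) :
    |apDiscrepancy (fun n => ((moebiusTrunc U : ArithmeticFunction ℝ) * vonMangoldtTrunc V *
        (ζ : ArithmeticFunction ℝ)) n) N q a| ≤ 2 * (U * Chebyshev.psi V) := by
  have h := typeI_apDiscrepancy_le ((moebiusTrunc U : ArithmeticFunction ℝ) * vonMangoldtTrunc V)
    (ζ : ArithmeticFunction ℝ) zeta_monotone
    (fun n => by simp only [ArithmeticFunction.natCoe_apply, ArithmeticFunction.zeta_apply]; split_ifs <;> simp)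
    hq a N
  refine h.trans ?_
  have hζ : ((ζ : ArithmeticFunction ℝ) N : ℝ) ≤ 1 := by
    simp only [ArithmeticFunction.natCoe_apply, ArithmeticFunction.zeta_apply]; split_ifs <;> simp
  have hsum : ∑ d ∈ Icc 1 N, |((moebiusTrunc U : ArithmeticFunction ℝ) * vonMangoldtTrunc V) d| ≤
      U * Chebyshev.psi V := by
    have hΛV : ∀ n, 0 ≤ vonMangoldtTrunc V n := fun n => by
      rw [vonMangoldtTrunc_apply]; split_ifs
      · exact ArithmeticFunction.vonMangoldt_nonneg
      · exact le_rfl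
    calc ∑ d ∈ Icc 1 N, |((moebiusTrunc U : ArithmeticFunction ℝ) * vonMangoldtTrunc V) d|
        ≤ ∑ d ∈ Icc 1 N, (absAF (moebiusTrunc U : ArithmeticFunction ℝ) * vonMangoldtTrunc V) d :=
          Finset.sum_le_sum fun d _ => abs_mul_apply_le_absAF_mul _ _ hΛV d
      _ ≤ (∑ m ∈ Icc 1 N, absAF (moebiusTrunc U : ArithmeticFunction ℝ) m) * ∑ c ∈ Icc 1 N, vonMangoldtTrunc V c :=
          sum_Icc_mul_le _ _ (fun _ => abs_nonneg _) hΛV N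
      _ ≤ (U : ℝ) * Chebyshev.psi V := by
          refine mul_le_mul ?_ ?_ (Finset.sum_nonneg fun _ _ => hΛV _) (Nat.cast_nonneg _)
          · calc ∑ m ∈ Icc 1 N, absAF (moebiusTrunc U : ArithmeticFunction ℝ) m
                ≤ ∑ m ∈ Icc 1 N, (if m ≤ U then (1 : ℝ) else 0) := by
                  refine Finset.sum_le_sum fun m _ => ?_
                  simp only [absAF_apply, ArithmeticFunction.intCoe_apply, moebiusTrunc_apply]
                  split_ifs
                  · exact_mod_cast ArithmeticFunction.abs_moebius_le_one
                  · simp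
              _ = #((Icc 1 N).filter fun d => d ≤ U) := by rw [← Finset.sum_filter]; simp
              _ ≤ #(Icc 1 U) := by
                  refine Nat.cast_le.2 (Finset.card_le_card fun d hd => ?_)
                  rw [Finset.mem_filter, Finset.mem_Icc] at hd
                  rw [Finset.mem_Icc]; omega
              _ = U := by simp
          · -- `Σ_{c ≤ N} Λ_{≤V}(c) ≤ ψ(V)`
            calc ∑ c ∈ Icc 1 N, vonMangoldtTrunc V c
                = ∑ c ∈ (Icc 1 N).filter (fun c => c ≤ V), (Λ c : ℝ) := by
                  rw [Finset.sum_filter]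
                  refine Finset.sum_congr rfl fun c _ => ?_
                  rw [vonMangoldtTrunc_apply]
              _ ≤ ∑ c ∈ Ioc 0 V, (Λ c : ℝ) := by
                  refine Finset.sum_le_sum_of_subset_of_nonneg ?_ fun _ _ _ => ArithmeticFunction.vonMangoldt_nonneg
                  intro c hc
                  rw [Finset.mem_filter, Finset.mem_Icc] at hc
                  rw [Finset.mem_Ioc]; omega
              _ = Chebyshev.psi V := by rw [Chebyshev.psi, Nat.floor_natCast]
  have hψ : 0 ≤ Chebyshev.psi V := Chebyshev.psi_nonneg _
  calc 2 * ((ζ : ArithmeticFunction ℝ) N : ℝ) * ∑ d ∈ Icc 1 N, |((moebiusTrunc U : ArithmeticFunction ℝ) * vonMangoldtTrunc V) d|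
      ≤ 2 * 1 * (U * Chebyshev.psi V) := by
        refine mul_le_mul (mul_le_mul_of_nonneg_left hζ (by norm_num)) hsum
          (Finset.sum_nonneg fun _ _ => abs_nonneg _) (by norm_num)
    _ = _ := by ring

/-! ### The window discrepancy of `Λ` at a large point `X` -/

/-- The relevant pairs inside the window. [folklore] -/
def relIn (ε₁ B₀ X : ℝ) : Finset (ℕ × ℕ) :=
  (range (Sidx B₀ X + 1) ×ˢ range (Sidx B₀ X + 1)).filter fun st =>
    Relevant ε₁ B₀ X st.1 st.2 ∧ Inside ε₁ B₀ X st.1 st.2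

/-- The relevant pairs straddling an end of the window. [folklore] -/
def relOut (ε₁ B₀ X : ℝ) : Finset (ℕ × ℕ) :=
  (range (Sidx B₀ X + 1) ×ˢ range (Sidx B₀ X + 1)).filter fun st =>
    Relevant ε₁ B₀ X st.1 st.2 ∧ ¬ Inside ε₁ B₀ X st.1 st.2

/-- **The window discrepancy of `Λ`, pointwise** (`X ≥ 16`, `X^{ε₁/2} ≥ 4`, `⌊X^{ε₁}⌋ ≤ ⌊X/2⌋`, `q ≥ 1`):
`|Δ_W(Λ)| ≤ 4 U log X + 4 U ψ(U) + Σ_{relevant inside} sup|Δ(γ; N')| + Σ_{relevant straddling} (2 sup|Δ(G; N')| + (4/φ(q)) ‖α‖₁‖β‖₁)`.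
[cite: Polymath8b2014, Proposition 2.7] -/
theorem abs_windowDisc_vonMangoldt_le (hε : 0 < ε₁) (hX : 16 ≤ X) (hE : 4 ≤ X ^ (ε₁ / 2))
    (hV : Ucut ε₁ X ≤ ⌊X / 2⌋₊) {q : ℕ} (hq : 1 ≤ q) (a : (ZMod q)ˣ) :
    |windowDisc (fun n => (Λ n : ℝ)) ⌊X / 2⌋₊ ⌊X⌋₊ q a| ≤
      (4 * Real.log X * Ucut ε₁ X + 4 * (Ucut ε₁ X * Chebyshev.psi (Ucut ε₁ X))) +
      ∑ st ∈ relIn ε₁ B₀ X, supDisc (pieceγ ε₁ B₀ X st.1 st.2) (cutN ε₁ B₀ X st.1 st.2) q +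
      ∑ st ∈ relOut ε₁ B₀ X, (2 * supDisc (pieceG ε₁ B₀ X st.1 st.2) (cutN ε₁ B₀ X st.1 st.2) q +
        4 / (Nat.totient q : ℝ) * l1mass ε₁ B₀ X st.1 st.2) := by
  have hX0 : 0 < X := by linarith
  have hX1 : 1 ≤ X := by linarith
  have h01 : ⌊X / 2⌋₊ ≤ ⌊X⌋₊ := Nat.floor_le_floor (by linarith)
  have hU1 : 1 ≤ Ucut ε₁ X := by
    unfold Ucut
    exact Nat.le_floor (by rw [Nat.cast_one]; exact Real.one_le_rpow hX1 hε.le)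
  have hρ1 := one_le_rho B₀ X
  have hN1 : ⌊X⌋₊ ≤ lo (rho B₀ X) (Sidx B₀ X + 1) := floor_le_lo_Sidx_succ B₀ hX1
  have hN0 : ⌊X / 2⌋₊ ≤ lo (rho B₀ X) (Sidx B₀ X + 1) := h01.trans hN1
  have d1 := apDiscrepancy_vonMangoldt_eq hU1 (Ucut ε₁ X) hρ1 (Sidx B₀ X) hN1 q a
  have d0 := apDiscrepancy_vonMangoldt_eq hU1 (Ucut ε₁ X) hρ1 (Sidx B₀ X) hN0 q a
  -- the `Λ_{≤V}` term does not see the window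
  have hΛV : apDiscrepancy (fun n => vonMangoldtTrunc (Ucut ε₁ X) n) ⌊X⌋₊ q a =
      apDiscrepancy (fun n => vonMangoldtTrunc (Ucut ε₁ X) n) ⌊X / 2⌋₊ q a := by
    have hs : ∀ n, Ucut ε₁ X < n → vonMangoldtTrunc (Ucut ε₁ X) n = 0 :=
      fun n hn => vonMangoldtTrunc_apply_of_lt _ n hn
    rw [apDiscrepancy_eq_of_support hs (hV.trans h01), apDiscrepancy_eq_of_support hs hV]
  -- Type I bounds at both cut-offs
  have hlog1 : Real.log (⌊X⌋₊ : ℕ) ≤ Real.log X :=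
    Real.log_le_log (by exact_mod_cast Nat.floor_pos.2 hX1) (Nat.floor_le hX0.le)
  have hlog0 : Real.log (⌊X / 2⌋₊ : ℕ) ≤ Real.log X := by
    have h8 : (8 : ℝ) ≤ ⌊X / 2⌋₊ := by
      have : (8 : ℕ) ≤ ⌊X / 2⌋₊ := Nat.le_floor (by push_cast; linarith)
      exact_mod_cast this
    exact Real.log_le_log (by linarith) ((Nat.floor_le (by linarith)).trans (by linarith))
  have hUnn : (0 : ℝ) ≤ Ucut ε₁ X := Nat.cast_nonneg _
  have t11 := abs_apDiscrepancy_typeI₁_le (Ucut ε₁ X) ⌊X⌋₊ hq a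
  have t10 := abs_apDiscrepancy_typeI₁_le (Ucut ε₁ X) ⌊X / 2⌋₊ hq a
  have t21 := abs_apDiscrepancy_typeI₂_le (Ucut ε₁ X) (Ucut ε₁ X) ⌊X⌋₊ hq a
  have t20 := abs_apDiscrepancy_typeI₂_le (Ucut ε₁ X) (Ucut ε₁ X) ⌊X / 2⌋₊ hq a
  have t11' : |apDiscrepancy (fun n => ((moebiusTrunc (Ucut ε₁ X) : ArithmeticFunction ℝ) *
      ArithmeticFunction.log) n) ⌊X⌋₊ q a| ≤ 2 * Real.log X * Ucut ε₁ X :=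
    t11.trans (mul_le_mul_of_nonneg_right (mul_le_mul_of_nonneg_left hlog1 (by norm_num)) hUnn)
  have t10' : |apDiscrepancy (fun n => ((moebiusTrunc (Ucut ε₁ X) : ArithmeticFunction ℝ) *
      ArithmeticFunction.log) n) ⌊X / 2⌋₊ q a| ≤ 2 * Real.log X * Ucut ε₁ X :=
    t10.trans (mul_le_mul_of_nonneg_right (mul_le_mul_of_nonneg_left hlog0 (by norm_num)) hUnn)
  -- the Type II pieces
  set P := range (Sidx B₀ X + 1) ×ˢ range (Sidx B₀ X + 1) with hP
  have hpieces : (∑ s ∈ range (Sidx B₀ X + 1), ∑ t ∈ range (Sidx B₀ X + 1),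
        apDiscrepancy (fun n => (alphaPiece (Ucut ε₁ X) (rho B₀ X) s * betaPiece (Ucut ε₁ X) (rho B₀ X) t) n) ⌊X⌋₊ q a) -
      (∑ s ∈ range (Sidx B₀ X + 1), ∑ t ∈ range (Sidx B₀ X + 1),
        apDiscrepancy (fun n => (alphaPiece (Ucut ε₁ X) (rho B₀ X) s * betaPiece (Ucut ε₁ X) (rho B₀ X) t) n) ⌊X / 2⌋₊ q a) =
      ∑ st ∈ P, windowDisc (pieceγ ε₁ B₀ X st.1 st.2) ⌊X / 2⌋₊ ⌊X⌋₊ q a := by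
    rw [hP, Finset.sum_product, ← Finset.sum_sub_distrib]
    refine Finset.sum_congr rfl fun s _ => ?_
    rw [← Finset.sum_sub_distrib]
    rfl
  have hbound : ∑ st ∈ P, |windowDisc (pieceγ ε₁ B₀ X st.1 st.2) ⌊X / 2⌋₊ ⌊X⌋₊ q a| ≤
      ∑ st ∈ relIn ε₁ B₀ X, supDisc (pieceγ ε₁ B₀ X st.1 st.2) (cutN ε₁ B₀ X st.1 st.2) q +
      ∑ st ∈ relOut ε₁ B₀ X, (2 * supDisc (pieceG ε₁ B₀ X st.1 st.2) (cutN ε₁ B₀ X st.1 st.2) q +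
        4 / (Nat.totient q : ℝ) * l1mass ε₁ B₀ X st.1 st.2) := by
    rw [← Finset.sum_filter_add_sum_filter_not P (fun st => Relevant ε₁ B₀ X st.1 st.2)]
    have hz : ∑ st ∈ P.filter (fun st => ¬ Relevant ε₁ B₀ X st.1 st.2),
        |windowDisc (pieceγ ε₁ B₀ X st.1 st.2) ⌊X / 2⌋₊ ⌊X⌋₊ q a| = 0 := by
      refine Finset.sum_eq_zero fun st hst => ?_
      rw [Finset.mem_filter] at hst
      unfold pieceγ
      rw [windowDisc_eq_zero_of_not_relevant hX hE hst.2 q a, abs_zero]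
    rw [hz, add_zero, ← Finset.sum_filter_add_sum_filter_not (P.filter fun st => Relevant ε₁ B₀ X st.1 st.2)
      (fun st => Inside ε₁ B₀ X st.1 st.2), Finset.filter_filter, Finset.filter_filter]
    refine add_le_add (Finset.sum_le_sum fun st hst => ?_) (Finset.sum_le_sum fun st hst => ?_)
    · rw [Finset.mem_filter] at hst
      exact abs_windowDisc_le_of_inside hst.2.1 hst.2.2 q a
    · rw [Finset.mem_filter] at hst
      exact abs_windowDisc_le_of_not_inside hst.2.1 hq a
  -- assemble
  unfold windowDisc
  rw [d1, d0]
  have habs := Finset.abs_sum_le_sum_abs (fun st => windowDisc (pieceγ ε₁ B₀ X st.1 st.2) ⌊X / 2⌋₊ ⌊X⌋₊ q a) P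
  have key : ∀ (A B C D A' B' C' D' : ℝ), A = A' →
      (A + B - C + D) - (A' + B' - C' + D') = (B - B') - (C - C') + (D - D') := by
    intros; subst_vars; ring
  rw [key _ _ _ _ _ _ _ _ hΛV, hpieces]
  have h1 := abs_add_le ((apDiscrepancy (fun n => ((moebiusTrunc (Ucut ε₁ X) : ArithmeticFunction ℝ) *
      ArithmeticFunction.log) n) ⌊X⌋₊ q a -
    apDiscrepancy (fun n => ((moebiusTrunc (Ucut ε₁ X) : ArithmeticFunction ℝ) * ArithmeticFunction.log) n) ⌊X / 2⌋₊ q a) -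
    (apDiscrepancy (fun n => ((moebiusTrunc (Ucut ε₁ X) : ArithmeticFunction ℝ) * vonMangoldtTrunc (Ucut ε₁ X) *
      (ζ : ArithmeticFunction ℝ)) n) ⌊X⌋₊ q a -
    apDiscrepancy (fun n => ((moebiusTrunc (Ucut ε₁ X) : ArithmeticFunction ℝ) * vonMangoldtTrunc (Ucut ε₁ X) *
      (ζ : ArithmeticFunction ℝ)) n) ⌊X / 2⌋₊ q a))
    (∑ st ∈ P, windowDisc (pieceγ ε₁ B₀ X st.1 st.2) ⌊X / 2⌋₊ ⌊X⌋₊ q a)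
  have h2 := abs_sub (apDiscrepancy (fun n => ((moebiusTrunc (Ucut ε₁ X) : ArithmeticFunction ℝ) *
      ArithmeticFunction.log) n) ⌊X⌋₊ q a -
    apDiscrepancy (fun n => ((moebiusTrunc (Ucut ε₁ X) : ArithmeticFunction ℝ) * ArithmeticFunction.log) n) ⌊X / 2⌋₊ q a)
    (apDiscrepancy (fun n => ((moebiusTrunc (Ucut ε₁ X) : ArithmeticFunction ℝ) * vonMangoldtTrunc (Ucut ε₁ X) *
      (ζ : ArithmeticFunction ℝ)) n) ⌊X⌋₊ q a -
    apDiscrepancy (fun n => ((moebiusTrunc (Ucut ε₁ X) : ArithmeticFunction ℝ) * vonMangoldtTrunc (Ucut ε₁ X) *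
      (ζ : ArithmeticFunction ℝ)) n) ⌊X / 2⌋₊ q a)
  have h3 := abs_sub (apDiscrepancy (fun n => ((moebiusTrunc (Ucut ε₁ X) : ArithmeticFunction ℝ) *
      ArithmeticFunction.log) n) ⌊X⌋₊ q a)
    (apDiscrepancy (fun n => ((moebiusTrunc (Ucut ε₁ X) : ArithmeticFunction ℝ) * ArithmeticFunction.log) n) ⌊X / 2⌋₊ q a)
  have h4 := abs_sub (apDiscrepancy (fun n => ((moebiusTrunc (Ucut ε₁ X) : ArithmeticFunction ℝ) * vonMangoldtTrunc (Ucut ε₁ X) *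
      (ζ : ArithmeticFunction ℝ)) n) ⌊X⌋₊ q a)
    (apDiscrepancy (fun n => ((moebiusTrunc (Ucut ε₁ X) : ArithmeticFunction ℝ) * vonMangoldtTrunc (Ucut ε₁ X) *
      (ζ : ArithmeticFunction ℝ)) n) ⌊X / 2⌋₊ q a)
  linarith [habs.trans hbound]

/-! ### Identification of the family members -/

/-- The discrepancy sum of the member `(0, s, t)` is `Σ_q sup_a |Δ(γ_{s,t}; N')|`. [folklore] -/
theorem gehSum_jenc_zero (ϑ : ℝ) {s t : ℕ} (hs : s < Sidx B₀ X + 1)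
    (h : Relevant ε₁ B₀ X s t) :
    gehSum ϑ 2 X (Nfam ε₁ B₀ X (jenc B₀ X 0 s t)) (Mfam ε₁ B₀ X (jenc B₀ X 0 s t))
      (αfam ε₁ B₀ X (jenc B₀ X 0 s t)) (βfam ε₁ B₀ X (jenc B₀ X 0 s t)) =
      ∑ q ∈ Icc 1 ⌊X ^ ϑ⌋₊, supDisc (pieceγ ε₁ B₀ X s t) (cutN ε₁ B₀ X s t) q := by
  unfold gehSum Nfam Mfam αfam βfam
  rw [js_jenc B₀ X (by norm_num) hs, jt_jenc B₀ X (by norm_num) hs, jflag_jenc B₀ X (by norm_num),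
    if_pos h, if_pos h, if_pos h, if_pos h, if_pos rfl]
  rfl

/-- The discrepancy sum of the member `(1, s, t)` is `Σ_q sup_a |Δ(G_{s,t}; N')|`. [folklore] -/
theorem gehSum_jenc_one (ϑ : ℝ) {s t : ℕ} (hs : s < Sidx B₀ X + 1)
    (h : Relevant ε₁ B₀ X s t) :
    gehSum ϑ 2 X (Nfam ε₁ B₀ X (jenc B₀ X 1 s t)) (Mfam ε₁ B₀ X (jenc B₀ X 1 s t))
      (αfam ε₁ B₀ X (jenc B₀ X 1 s t)) (βfam ε₁ B₀ X (jenc B₀ X 1 s t)) =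
      ∑ q ∈ Icc 1 ⌊X ^ ϑ⌋₊, supDisc (pieceG ε₁ B₀ X s t) (cutN ε₁ B₀ X s t) q := by
  unfold gehSum Nfam Mfam αfam βfam
  rw [js_jenc B₀ X (by norm_num) hs, jt_jenc B₀ X (by norm_num) hs, jflag_jenc B₀ X (by norm_num),
    if_pos h, if_pos h, if_pos h, if_pos h, if_neg (by norm_num)]
  rfl

/-! ### Summing over the moduli -/

/-- `Σ_{s ∪ t} f ≤ Σ_s f + Σ_t f` for `f ≥ 0`. [folklore] -/
theorem sum_union_le_of_nonneg {ι : Type*} [DecidableEq ι] (s t : Finset ι) {f : ι → ℝ} (hf : ∀ i, 0 ≤ f i) :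
    ∑ i ∈ s ∪ t, f i ≤ ∑ i ∈ s, f i + ∑ i ∈ t, f i := by
  rw [← Finset.union_sdiff_self_eq_union, Finset.sum_union Finset.disjoint_sdiff]
  have := Finset.sum_le_sum_of_subset_of_nonneg (f := f) (Finset.sdiff_subset (s := t) (t := s)) fun i _ _ => hf i
  linarith

/-- **The window discrepancy of `Λ` summed over the moduli, at a large point `X`** (no asymptotics yet):
with `Q = ⌊X^ϑ⌋` and any bound `G₀` for the discrepancy sums of the family members,
`Σ_{q ≤ Q} sup_a |Δ_W(Λ)| ≤ Q (4 U log X + 4 U ψ(U)) + 3 (S+1)² G₀ + 4 (1 + log Q)² Σ_{n ∈ R} τ(n) log n`.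
[cite: Polymath8b2014, Proposition 2.7] -/
theorem sum_iSup_windowDisc_le (ϑ : ℝ) (hε : 0 < ε₁) (hX : 16 ≤ X) (hE : 4 ≤ X ^ (ε₁ / 2))
    (hV : Ucut ε₁ X ≤ ⌊X / 2⌋₊) {G₀ : ℝ} (hG₀ : 0 ≤ G₀)
    (hfam : ∀ j < Jfam B₀ X, gehSum ϑ 2 X (Nfam ε₁ B₀ X j) (Mfam ε₁ B₀ X j) (αfam ε₁ B₀ X j) (βfam ε₁ B₀ X j) ≤ G₀) :
    ∑ q ∈ Icc 1 ⌊X ^ ϑ⌋₊, (⨆ a : (ZMod q)ˣ, |windowDisc (fun n => (Λ n : ℝ)) ⌊X / 2⌋₊ ⌊X⌋₊ q a|) ≤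
      ⌊X ^ ϑ⌋₊ * (4 * Real.log X * Ucut ε₁ X + 4 * (Ucut ε₁ X * Chebyshev.psi (Ucut ε₁ X))) +
      3 * ((Sidx B₀ X + 1 : ℕ) : ℝ) ^ 2 * G₀ +
      4 * (1 + Real.log ⌊X ^ ϑ⌋₊) ^ 2 *
        ∑ n ∈ straddleRange (rho B₀ X) ⌊X / 2⌋₊ ⌊X⌋₊, (σ 0 n : ℝ) * Real.log n := by
  set Q := ⌊X ^ ϑ⌋₊ with hQ
  set EI : ℝ := 4 * Real.log X * Ucut ε₁ X + 4 * (Ucut ε₁ X * Chebyshev.psi (Ucut ε₁ X)) with hEI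
  -- pointwise bound, then `ciSup_le`
  have step1 : ∀ q ∈ Icc 1 Q, (⨆ a : (ZMod q)ˣ, |windowDisc (fun n => (Λ n : ℝ)) ⌊X / 2⌋₊ ⌊X⌋₊ q a|) ≤
      EI + ∑ st ∈ relIn ε₁ B₀ X, supDisc (pieceγ ε₁ B₀ X st.1 st.2) (cutN ε₁ B₀ X st.1 st.2) q +
      ∑ st ∈ relOut ε₁ B₀ X, (2 * supDisc (pieceG ε₁ B₀ X st.1 st.2) (cutN ε₁ B₀ X st.1 st.2) q +
        4 / (Nat.totient q : ℝ) * l1mass ε₁ B₀ X st.1 st.2) := by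
    intro q hq
    rw [Finset.mem_Icc] at hq
    haveI : NeZero q := ⟨by omega⟩
    haveI : Nonempty (ZMod q)ˣ := ⟨1⟩
    exact ciSup_le fun a => abs_windowDisc_vonMangoldt_le hε hX hE hV hq.1 a
  refine (Finset.sum_le_sum step1).trans ?_
  rw [Finset.sum_add_distrib, Finset.sum_add_distrib, Finset.sum_const, Nat.card_Icc, add_tsub_cancel_right,
    nsmul_eq_mul]
  -- the three GEH-type sums
  have hS := fun (st : ℕ × ℕ) (hst : st ∈ range (Sidx B₀ X + 1) ×ˢ range (Sidx B₀ X + 1)) =>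
    (Finset.mem_product.1 hst)
  have hIn : ∑ q ∈ Icc 1 Q, ∑ st ∈ relIn ε₁ B₀ X, supDisc (pieceγ ε₁ B₀ X st.1 st.2) (cutN ε₁ B₀ X st.1 st.2) q ≤
      ((Sidx B₀ X + 1 : ℕ) : ℝ) ^ 2 * G₀ := by
    rw [Finset.sum_comm]
    calc ∑ st ∈ relIn ε₁ B₀ X, ∑ q ∈ Icc 1 Q, supDisc (pieceγ ε₁ B₀ X st.1 st.2) (cutN ε₁ B₀ X st.1 st.2) q
        ≤ ∑ _st ∈ relIn ε₁ B₀ X, G₀ := by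
          refine Finset.sum_le_sum fun st hst => ?_
          rw [relIn, Finset.mem_filter, Finset.mem_product, Finset.mem_range, Finset.mem_range] at hst
          rw [hQ, ← gehSum_jenc_zero ϑ hst.1.1 hst.2.1]
          exact hfam _ (jenc_lt B₀ X (by norm_num) hst.1.1 hst.1.2)
      _ = #(relIn ε₁ B₀ X) * G₀ := by rw [Finset.sum_const, nsmul_eq_mul]
      _ ≤ ((Sidx B₀ X + 1 : ℕ) : ℝ) ^ 2 * G₀ := by
          refine mul_le_mul_of_nonneg_right ?_ hG₀
          have : #(relIn ε₁ B₀ X) ≤ (Sidx B₀ X + 1) ^ 2 := by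
            refine (Finset.card_filter_le _ _).trans ?_
            rw [Finset.card_product, Finset.card_range, sq]
          exact_mod_cast this
  have hOut : ∑ q ∈ Icc 1 Q, ∑ st ∈ relOut ε₁ B₀ X, (2 * supDisc (pieceG ε₁ B₀ X st.1 st.2) (cutN ε₁ B₀ X st.1 st.2) q +
        4 / (Nat.totient q : ℝ) * l1mass ε₁ B₀ X st.1 st.2) ≤
      2 * (((Sidx B₀ X + 1 : ℕ) : ℝ) ^ 2 * G₀) +
      4 * (1 + Real.log Q) ^ 2 * ∑ n ∈ straddleRange (rho B₀ X) ⌊X / 2⌋₊ ⌊X⌋₊, (σ 0 n : ℝ) * Real.log n := by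
    rw [Finset.sum_comm]
    simp only [Finset.sum_add_distrib]
    refine add_le_add ?_ ?_
    · -- the GEH part
      calc ∑ st ∈ relOut ε₁ B₀ X, ∑ q ∈ Icc 1 Q, 2 * supDisc (pieceG ε₁ B₀ X st.1 st.2) (cutN ε₁ B₀ X st.1 st.2) q
          ≤ ∑ _st ∈ relOut ε₁ B₀ X, 2 * G₀ := by
            refine Finset.sum_le_sum fun st hst => ?_
            rw [relOut, Finset.mem_filter, Finset.mem_product, Finset.mem_range, Finset.mem_range] at hst
            rw [← Finset.mul_sum, hQ, ← gehSum_jenc_one ϑ hst.1.1 hst.2.1]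
            exact mul_le_mul_of_nonneg_left (hfam _ (jenc_lt B₀ X (by norm_num) hst.1.1 hst.1.2)) (by norm_num)
        _ = #(relOut ε₁ B₀ X) * (2 * G₀) := by rw [Finset.sum_const, nsmul_eq_mul]
        _ ≤ ((Sidx B₀ X + 1 : ℕ) : ℝ) ^ 2 * (2 * G₀) := by
            refine mul_le_mul_of_nonneg_right ?_ (by positivity)
            have : #(relOut ε₁ B₀ X) ≤ (Sidx B₀ X + 1) ^ 2 := by
              refine (Finset.card_filter_le _ _).trans ?_
              rw [Finset.card_product, Finset.card_range, sq]
            exact_mod_cast this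
        _ = _ := by ring
    · -- the ℓ¹ part
      have hl1 : ∀ st ∈ relOut ε₁ B₀ X, ∑ q ∈ Icc 1 Q, 4 / (Nat.totient q : ℝ) * l1mass ε₁ B₀ X st.1 st.2 =
          4 * (∑ q ∈ Icc 1 Q, 1 / (Nat.totient q : ℝ)) * l1mass ε₁ B₀ X st.1 st.2 := by
        intro st _
        rw [Finset.mul_sum, Finset.sum_mul]
        refine Finset.sum_congr rfl fun q _ => ?_
        ring
      rw [Finset.sum_congr rfl hl1, ← Finset.mul_sum]
      have hφ : ∑ q ∈ Icc 1 Q, 1 / (Nat.totient q : ℝ) ≤ (1 + Real.log Q) ^ 2 := sum_Icc_one_div_totient_le_sq Q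
      have hφ0 : 0 ≤ ∑ q ∈ Icc 1 Q, 1 / (Nat.totient q : ℝ) := Finset.sum_nonneg fun q _ => by positivity
      have hL : ∑ st ∈ relOut ε₁ B₀ X, l1mass ε₁ B₀ X st.1 st.2 ≤
          ∑ n ∈ straddleRange (rho B₀ X) ⌊X / 2⌋₊ ⌊X⌋₊, (σ 0 n : ℝ) * Real.log n := by
        refine le_trans ?_ (sum_straddle_l1_le (Ucut ε₁ X) (Ucut ε₁ X) (one_le_rho B₀ X) (Sidx B₀ X) ⌊X / 2⌋₊ ⌊X⌋₊)
        refine Finset.sum_le_sum_of_subset_of_nonneg ?_ fun st _ _ => l1mass_nonneg _ _ _ _ _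
        intro st hst
        rw [relOut, Finset.mem_filter, Finset.mem_product, Finset.mem_range, Finset.mem_range] at hst
        exact mem_straddleSet_of_relevant_not_inside hst.1.1 hst.1.2 hst.2.1 hst.2.2
      have hL0 : 0 ≤ ∑ st ∈ relOut ε₁ B₀ X, l1mass ε₁ B₀ X st.1 st.2 :=
        Finset.sum_nonneg fun st _ => l1mass_nonneg _ _ _ _ _
      calc 4 * (∑ q ∈ Icc 1 Q, 1 / (Nat.totient q : ℝ)) * ∑ st ∈ relOut ε₁ B₀ X, l1mass ε₁ B₀ X st.1 st.2
          ≤ 4 * (1 + Real.log Q) ^ 2 * ∑ st ∈ relOut ε₁ B₀ X, l1mass ε₁ B₀ X st.1 st.2 :=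
            mul_le_mul_of_nonneg_right (mul_le_mul_of_nonneg_left hφ (by norm_num)) hL0
        _ ≤ _ := mul_le_mul_of_nonneg_left hL (by positivity)
  have e3 : 3 * ((Sidx B₀ X + 1 : ℕ) : ℝ) ^ 2 * G₀ =
      ((Sidx B₀ X + 1 : ℕ) : ℝ) ^ 2 * G₀ + 2 * (((Sidx B₀ X + 1 : ℕ) : ℝ) ^ 2 * G₀) := by ring
  rw [e3]
  linarith

/-! ### Asymptotics -/

/-- `ρ² − ρ⁻² ≤ 7 δ` for `ρ = 1 + δ`, `δ ≤ 1/3`. [folklore] -/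
theorem rho_sq_sub_inv_sq_le (B₀ X : ℝ) : rho B₀ X ^ 2 - (rho B₀ X ^ 2)⁻¹ ≤ 7 * delta B₀ X := by
  have hδ := delta_pos B₀ X
  have hδ1 := delta_le B₀ X
  have hρ1 := one_le_rho B₀ X
  have hρ2 : 1 ≤ rho B₀ X ^ 2 := one_le_pow₀ hρ1
  -- `ρ² - ρ⁻² ≤ ρ⁴ - 1` since `ρ⁻² ≥ ... `: use `ρ² - 1/ρ² = (ρ⁴ - 1)/ρ² ≤ ρ⁴ - 1`
  have h1 : rho B₀ X ^ 2 - (rho B₀ X ^ 2)⁻¹ ≤ rho B₀ X ^ 4 - 1 := by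
    have e : rho B₀ X ^ 2 - (rho B₀ X ^ 2)⁻¹ = (rho B₀ X ^ 4 - 1) / rho B₀ X ^ 2 := by
      field_simp
    rw [e]
    exact div_le_self (by nlinarith) hρ2
  have h2 : rho B₀ X ^ 4 - 1 ≤ 7 * delta B₀ X := by
    unfold rho
    have e : (1 + delta B₀ X) ^ 4 - 1 =
        delta B₀ X * (4 + 6 * delta B₀ X + 4 * delta B₀ X ^ 2 + delta B₀ X ^ 3) := by ring
    rw [e]
    have hd2 : delta B₀ X ^ 2 ≤ 1 / 9 := by nlinarith
    have hd3 : delta B₀ X ^ 3 ≤ 1 / 27 := by nlinarith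
    have : 4 + 6 * delta B₀ X + 4 * delta B₀ X ^ 2 + delta B₀ X ^ 3 ≤ 7 := by nlinarith
    calc delta B₀ X * (4 + 6 * delta B₀ X + 4 * delta B₀ X ^ 2 + delta B₀ X ^ 3) ≤ delta B₀ X * 7 :=
          mul_le_mul_of_nonneg_left this hδ.le
      _ = 7 * delta B₀ X := by ring
  linarith

/-- One short range: for `X ≥ 16`, `Y ≤ X`,
`Σ_{n ∈ (⌊Y/ρ²⌋, ⌊ρ²Y⌋]} τ(n) log n ≤ 84 δ X (log X)² + 12 (log X)² + 8 (log X) √X`. [folklore] -/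
theorem sum_range_sigma_log_le (hX : 16 ≤ X) {Y : ℕ} (hY : (Y : ℝ) ≤ X) :
    ∑ n ∈ Ioc ⌊(Y : ℝ) / rho B₀ X ^ 2⌋₊ ⌊rho B₀ X ^ 2 * Y⌋₊, (σ 0 n : ℝ) * Real.log n ≤
      84 * delta B₀ X * X * Real.log X ^ 2 + 12 * Real.log X ^ 2 + 8 * Real.log X * Real.sqrt X := by
  have hX0 : 0 < X := by linarith
  have hL : Real.log 2 ≤ Real.log X := Real.log_le_log (by norm_num) (by linarith)
  have hL2 : (0.5 : ℝ) < Real.log 2 := by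
    have := Real.log_two_gt_d9; linarith
  have hL1 : 1 ≤ Real.log X := by
    have : (1 : ℝ) ≤ Real.log 4 := by
      rw [show (4 : ℝ) = 2 ^ 2 by norm_num, Real.log_pow]; push_cast; linarith
    exact this.trans (Real.log_le_log (by norm_num) (by linarith))
  have hρ1 := one_le_rho B₀ X
  have hρ43 := rho_le B₀ X
  have hδ := delta_pos B₀ X
  have hρ2 : 1 ≤ rho B₀ X ^ 2 := one_le_pow₀ hρ1
  have hρ2' : rho B₀ X ^ 2 ≤ 2 := by nlinarith
  set a := ⌊(Y : ℝ) / rho B₀ X ^ 2⌋₊ with ha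
  set b := ⌊rho B₀ X ^ 2 * Y⌋₊ with hb
  have hY0 : (0 : ℝ) ≤ Y := Nat.cast_nonneg _
  have hb2X : (b : ℝ) ≤ 2 * X := (Nat.floor_le (by positivity)).trans (by nlinarith)
  by_cases hab : a ≤ b
  swap
  · rw [Finset.Ioc_eq_empty (fun h => hab h.le), Finset.sum_empty]
    have : 0 ≤ Real.log X := by linarith
    positivity
  have hba : (b : ℝ) - a ≤ 7 * delta B₀ X * X + 1 := by
    have h1 : (b : ℝ) ≤ rho B₀ X ^ 2 * Y := Nat.floor_le (by positivity)
    have h2 : (Y : ℝ) / rho B₀ X ^ 2 - 1 ≤ a := by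
      have := Nat.lt_floor_add_one ((Y : ℝ) / rho B₀ X ^ 2); rw [← ha] at this; linarith
    have h3 : rho B₀ X ^ 2 * Y - (Y : ℝ) / rho B₀ X ^ 2 = (rho B₀ X ^ 2 - (rho B₀ X ^ 2)⁻¹) * Y := by ring
    have h4 := rho_sq_sub_inv_sq_le B₀ X
    have h5 : (rho B₀ X ^ 2 - (rho B₀ X ^ 2)⁻¹) * Y ≤ 7 * delta B₀ X * X := by
      have h6 : 0 ≤ rho B₀ X ^ 2 - (rho B₀ X ^ 2)⁻¹ := by
        rw [sub_nonneg]; exact (inv_le_one_of_one_le₀ hρ2).trans hρ2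
      calc (rho B₀ X ^ 2 - (rho B₀ X ^ 2)⁻¹) * Y ≤ (7 * delta B₀ X) * Y := mul_le_mul_of_nonneg_right h4 hY0
        _ ≤ (7 * delta B₀ X) * X := mul_le_mul_of_nonneg_left hY (by positivity)
        _ = _ := by ring
    linarith
  -- log n ≤ log (2X) ≤ 2 log X on the range
  have hlog2X : Real.log (2 * X) ≤ 2 * Real.log X := by
    rw [Real.log_mul (by norm_num) hX0.ne']; linarith
  have step1 : ∑ n ∈ Ioc a b, (σ 0 n : ℝ) * Real.log n ≤ (2 * Real.log X) * ∑ n ∈ Ioc a b, (σ 0 n : ℝ) := by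
    rw [Finset.mul_sum]
    refine Finset.sum_le_sum fun n hn => ?_
    rw [Finset.mem_Ioc] at hn
    rw [mul_comm]
    refine mul_le_mul_of_nonneg_right ?_ (Nat.cast_nonneg _)
    have hn1 : (1 : ℝ) ≤ n := by exact_mod_cast (show 1 ≤ n by omega)
    have hnb : (n : ℝ) ≤ b := by exact_mod_cast hn.2
    exact (Real.log_le_log (by linarith) (hnb.trans hb2X)).trans hlog2X
  have step2 := sum_Ioc_sigma_zero_le hab
  have hlogb : 1 + Real.log b ≤ 3 * Real.log X := by
    rcases Nat.eq_zero_or_pos b with hb0 | hb0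
    · rw [hb0]; simp; linarith
    · have : Real.log b ≤ Real.log (2 * X) := Real.log_le_log (by exact_mod_cast hb0) hb2X
      linarith
  have hsqrt : Real.sqrt b ≤ 2 * Real.sqrt X := by
    calc Real.sqrt b ≤ Real.sqrt (4 * X) := Real.sqrt_le_sqrt (by linarith)
      _ = 2 * Real.sqrt X := by
          rw [Real.sqrt_mul (by norm_num), show (4 : ℝ) = 2 ^ 2 by norm_num, Real.sqrt_sq (by norm_num)]
  have hbapos : 0 ≤ (b : ℝ) - a := by
    have : (a : ℝ) ≤ b := by exact_mod_cast hab
    linarith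
  have step3 : ∑ n ∈ Ioc a b, (σ 0 n : ℝ) ≤
      2 * ((7 * delta B₀ X * X + 1) * (3 * Real.log X)) + 2 * (2 * Real.sqrt X) := by
    refine step2.trans ?_
    have := mul_le_mul hba hlogb (by linarith [Real.log_natCast_nonneg b]) (by positivity)
    linarith
  have hsum0 : 0 ≤ ∑ n ∈ Ioc a b, (σ 0 n : ℝ) := Finset.sum_nonneg fun _ _ => Nat.cast_nonneg _
  calc ∑ n ∈ Ioc a b, (σ 0 n : ℝ) * Real.log n ≤ (2 * Real.log X) * ∑ n ∈ Ioc a b, (σ 0 n : ℝ) := step1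
    _ ≤ (2 * Real.log X) * (2 * ((7 * delta B₀ X * X + 1) * (3 * Real.log X)) + 2 * (2 * Real.sqrt X)) :=
        mul_le_mul_of_nonneg_left step3 (by positivity)
    _ = 84 * delta B₀ X * X * Real.log X ^ 2 + 12 * Real.log X ^ 2 + 8 * Real.log X * Real.sqrt X := by ring

/-- The straddle term: for `X ≥ 16`,
`4 (1 + log Q)² Σ_{n ∈ R} τ(n) log n ≤ 2688 δ X (log X)⁴ + 384 (log X)⁴ + 256 (log X)³ √X`
(`Q = ⌊X^ϑ⌋ ≤ X`). [folklore] -/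
theorem straddle_term_le {ϑ : ℝ} (hϑ1 : ϑ ≤ 1) (hX : 16 ≤ X) :
    4 * (1 + Real.log ⌊X ^ ϑ⌋₊) ^ 2 *
        ∑ n ∈ straddleRange (rho B₀ X) ⌊X / 2⌋₊ ⌊X⌋₊, (σ 0 n : ℝ) * Real.log n ≤
      2688 * delta B₀ X * X * Real.log X ^ 4 + 384 * Real.log X ^ 4 + 256 * Real.log X ^ 3 * Real.sqrt X := by
  have hX0 : 0 < X := by linarith
  have hX1 : 1 ≤ X := by linarith
  have hL1 : 1 ≤ Real.log X := by
    have hL : Real.log 2 ≤ Real.log X := Real.log_le_log (by norm_num) (by linarith)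
    have := Real.log_two_gt_d9
    have : (1 : ℝ) ≤ Real.log 4 := by
      rw [show (4 : ℝ) = 2 ^ 2 by norm_num, Real.log_pow]; push_cast; linarith
    exact this.trans (Real.log_le_log (by norm_num) (by linarith))
  have hδ := delta_pos B₀ X
  -- `(1 + log Q)² ≤ 4 (log X)²`
  have hQ : (1 + Real.log ⌊X ^ ϑ⌋₊) ^ 2 ≤ 4 * Real.log X ^ 2 := by
    have h1 : Real.log ⌊X ^ ϑ⌋₊ ≤ Real.log X := by
      rcases Nat.eq_zero_or_pos ⌊X ^ ϑ⌋₊ with h0 | h0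
      · rw [h0]; simp; linarith
      · refine Real.log_le_log (by exact_mod_cast h0) ((Nat.floor_le (Real.rpow_nonneg hX0.le _)).trans ?_)
        calc X ^ ϑ ≤ X ^ (1 : ℝ) := Real.rpow_le_rpow_of_exponent_le hX1 hϑ1
          _ = X := Real.rpow_one X
    have h2 : 0 ≤ 1 + Real.log ⌊X ^ ϑ⌋₊ := by linarith [Real.log_natCast_nonneg ⌊X ^ ϑ⌋₊]
    nlinarith
  -- the two ranges
  have hN1 : ((⌊X⌋₊ : ℕ) : ℝ) ≤ X := Nat.floor_le hX0.le
  have hN0 : ((⌊X / 2⌋₊ : ℕ) : ℝ) ≤ X := (Nat.floor_le (by linarith)).trans (by linarith)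
  have r0 := sum_range_sigma_log_le (B₀ := B₀) hX hN0
  have r1 := sum_range_sigma_log_le (B₀ := B₀) hX hN1
  have hR : ∑ n ∈ straddleRange (rho B₀ X) ⌊X / 2⌋₊ ⌊X⌋₊, (σ 0 n : ℝ) * Real.log n ≤
      2 * (84 * delta B₀ X * X * Real.log X ^ 2 + 12 * Real.log X ^ 2 + 8 * Real.log X * Real.sqrt X) := by
    unfold straddleRange
    refine (sum_union_le_of_nonneg _ _ fun n => ?_).trans (by linarith)
    exact mul_nonneg (Nat.cast_nonneg _) (Real.log_natCast_nonneg n)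
  have hR0 : 0 ≤ ∑ n ∈ straddleRange (rho B₀ X) ⌊X / 2⌋₊ ⌊X⌋₊, (σ 0 n : ℝ) * Real.log n :=
    Finset.sum_nonneg fun n _ => mul_nonneg (Nat.cast_nonneg _) (Real.log_natCast_nonneg n)
  calc 4 * (1 + Real.log ⌊X ^ ϑ⌋₊) ^ 2 * ∑ n ∈ straddleRange (rho B₀ X) ⌊X / 2⌋₊ ⌊X⌋₊, (σ 0 n : ℝ) * Real.log n
      ≤ 4 * (4 * Real.log X ^ 2) *
          (2 * (84 * delta B₀ X * X * Real.log X ^ 2 + 12 * Real.log X ^ 2 + 8 * Real.log X * Real.sqrt X)) :=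
        mul_le_mul (mul_le_mul_of_nonneg_left hQ (by norm_num)) hR hR0 (by positivity)
    _ = _ := by ring

/-- The grid count: `(S+1)² ≤ 16 (log X)^{2B₀+2}` once `(log X)^{B₀} ≥ 3` (`B₀ ≥ 0`, `log X ≥ 1`). [folklore] -/
theorem Sidx_succ_sq_le {B₀ : ℝ} (hB₀ : 0 ≤ B₀) (hL1 : 1 ≤ Real.log X) (h3 : 3 ≤ Real.log X ^ B₀) :
    ((Sidx B₀ X + 1 : ℕ) : ℝ) ^ 2 ≤ 16 * Real.log X ^ (2 * B₀ + 2) := by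
  have hL0 : 0 < Real.log X := by linarith
  have hδ : delta B₀ X = 1 / Real.log X ^ B₀ := by
    unfold delta; rw [max_eq_right h3]
  have hS : (Sidx B₀ X : ℝ) ≤ 2 * Real.log X ^ (B₀ + 1) + 1 := by
    unfold Sidx
    have h1 : 2 * Real.log X / delta B₀ X = 2 * Real.log X ^ (B₀ + 1) := by
      rw [hδ, Real.rpow_add hL0, Real.rpow_one]; field_simp
    rw [h1]
    have := Nat.ceil_lt_add_one (show 0 ≤ 2 * Real.log X ^ (B₀ + 1) by positivity)
    linarith [this]
  have hpow1 : 1 ≤ Real.log X ^ (B₀ + 1) := Real.one_le_rpow hL1 (by linarith)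
  have hS1 : ((Sidx B₀ X + 1 : ℕ) : ℝ) ≤ 4 * Real.log X ^ (B₀ + 1) := by push_cast; linarith
  have hsq : (Real.log X ^ (B₀ + 1)) ^ 2 = Real.log X ^ (2 * B₀ + 2) := by
    rw [← Real.rpow_natCast, ← Real.rpow_mul hL0.le]; congr 1; push_cast; ring
  calc ((Sidx B₀ X + 1 : ℕ) : ℝ) ^ 2 ≤ (4 * Real.log X ^ (B₀ + 1)) ^ 2 :=
        pow_le_pow_left₀ (Nat.cast_nonneg _) hS1 2
    _ = 16 * Real.log X ^ (2 * B₀ + 2) := by rw [mul_pow, hsq]; norm_num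

/-! ### The window estimate -/

/-- **`EH[ϑ]` in window form from `GEH[ϑ]`** (Proposition 2.7, the Type I/II analysis at one
point): for `0 < ϑ < 1` with `GEH[ϑ]` and every `A > 0` there is `C` with, eventually in `X`,
`Σ_{q ≤ X^ϑ} sup_{(a,q)=1} |Δ(Λ; ⌊X⌋; a (q)) − Δ(Λ; ⌊X/2⌋; a (q))| ≤ C X (log X)^{-A}`.
[cite: Polymath8b2014, Proposition 2.7] -/
theorem ehWindow_of_geh {ϑ : ℝ} (hϑ0 : 0 < ϑ) (hϑ1 : ϑ < 1) (hGEH : GeneralizedElliottHalberstam ϑ)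
    {A : ℝ} (hA : 0 < A) :
    ∃ C : ℝ, ∀ᶠ X : ℝ in atTop,
      ∑ q ∈ Icc 1 ⌊X ^ ϑ⌋₊, (⨆ a : (ZMod q)ˣ,
        |apDiscrepancy (fun n => (Λ n : ℝ)) ⌊X⌋₊ q a - apDiscrepancy (fun n => (Λ n : ℝ)) ⌊X / 2⌋₊ q a|) ≤
      C * X / Real.log X ^ A := by
  -- parameters
  set ε₁ : ℝ := (1 - ϑ) / 4 with hε₁
  have hε : 0 < ε₁ := by rw [hε₁]; linarith
  have hε2 : ε₁ ≤ 1 / 2 := by rw [hε₁]; linarith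
  set B₀ : ℝ := A + 5 with hB₀
  have hB₀0 : 0 < B₀ := by rw [hB₀]; linarith
  set A' : ℝ := 2 * B₀ + 2 + A with hA'
  have hA'0 : 0 < A' := by rw [hA']; linarith
  obtain ⟨C₀, hC₀⟩ := gehFamily_bound hGEH hε hε2 B₀ hA'0
  refine ⟨2 + 48 * max C₀ 0, ?_⟩
  -- eventual conditions
  have eX : ∀ᶠ X : ℝ in atTop, 16 ≤ X := eventually_ge_atTop _
  have eE : ∀ᶠ X : ℝ in atTop, 4 ≤ X ^ (ε₁ / 2) := (tendsto_rpow_atTop (by linarith)).eventually_ge_atTop _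
  have hgap : 0 < (1 - ϑ) / 2 := by linarith
  have e1 : ∀ᶠ X : ℝ in atTop, 26 * Real.log X ^ (A + 1) ≤ X ^ ((1 - ϑ) / 2) := by
    have := (isLittleO_log_rpow_rpow_atTop (A + 1) hgap).bound (show (0 : ℝ) < 1 / 26 by norm_num)
    filter_upwards [this, eventually_ge_atTop (1 : ℝ)] with X hX hX1
    rw [Real.norm_of_nonneg (Real.rpow_nonneg (Real.log_nonneg hX1) _),
      Real.norm_of_nonneg (Real.rpow_nonneg (by linarith) _)] at hX
    linarith
  have e2 : ∀ᶠ X : ℝ in atTop, 3 ≤ Real.log X ^ B₀ :=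
    ((tendsto_rpow_atTop hB₀0).comp Real.tendsto_log_atTop).eventually_ge_atTop _
  have e3 : ∀ᶠ X : ℝ in atTop, 8064 ≤ Real.log X := Real.tendsto_log_atTop.eventually_ge_atTop _
  have e4 : ∀ᶠ X : ℝ in atTop, 1152 * Real.log X ^ (A + 4) ≤ X := by
    have := (isLittleO_log_rpow_rpow_atTop (A + 4) zero_lt_one).bound (show (0 : ℝ) < 1 / 1152 by norm_num)
    filter_upwards [this, eventually_ge_atTop (1 : ℝ)] with X hX hX1
    rw [Real.norm_of_nonneg (Real.rpow_nonneg (Real.log_nonneg hX1) _),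
      Real.norm_of_nonneg (Real.rpow_nonneg (by linarith) _), Real.rpow_one] at hX
    linarith
  have e5 : ∀ᶠ X : ℝ in atTop, 768 * Real.log X ^ (A + 3) ≤ Real.sqrt X := by
    have := (isLittleO_log_rpow_rpow_atTop (A + 3) (by norm_num : (0 : ℝ) < 1 / 2)).bound
      (show (0 : ℝ) < 1 / 768 by norm_num)
    filter_upwards [this, eventually_ge_atTop (1 : ℝ)] with X hX hX1
    rw [Real.norm_of_nonneg (Real.rpow_nonneg (Real.log_nonneg hX1) _),
      Real.norm_of_nonneg (Real.rpow_nonneg (by linarith) _), ← Real.sqrt_eq_rpow] at hX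
    linarith
  filter_upwards [eX, eE, hC₀, e1, e2, e3, e4, e5] with X hX hE hC₀X hX1' hX2' hX3' hX4' hX5'
  -- basic facts
  have hX0 : 0 < X := by linarith
  have hX1 : 1 ≤ X := by linarith
  have hL1 : 1 ≤ Real.log X := by linarith
  have hL0 : 0 < Real.log X := by linarith
  set L := Real.log X with hLdef
  have hLA : 0 < L ^ A := Real.rpow_pos_of_pos hL0 A
  -- `U ≤ ⌊X/2⌋`
  have hUle : (Ucut ε₁ X : ℝ) ≤ X ^ ε₁ := Nat.floor_le (Real.rpow_nonneg hX0.le _)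
  have hXε : X ^ ε₁ ≤ Real.sqrt X := by
    rw [Real.sqrt_eq_rpow]; exact Real.rpow_le_rpow_of_exponent_le hX1 hε2
  have hsqrtX : Real.sqrt X ≤ X / 2 := by
    rw [Real.sqrt_le_iff]; constructor
    · positivity
    · nlinarith
  have hV : Ucut ε₁ X ≤ ⌊X / 2⌋₊ := Nat.le_floor ((hUle.trans hXε).trans hsqrtX)
  -- the family bound at this `X`
  have hXA' : 0 ≤ X / L ^ A' := by positivity
  have hG₀ : 0 ≤ max C₀ 0 * (X / L ^ A') := by positivity
  have hfam : ∀ j < Jfam B₀ X, gehSum ϑ 2 X (Nfam ε₁ B₀ X j) (Mfam ε₁ B₀ X j) (αfam ε₁ B₀ X j) (βfam ε₁ B₀ X j) ≤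
      max C₀ 0 * (X / L ^ A') :=
    fun j hj => (hC₀X j hj).trans (mul_le_mul_of_nonneg_right (le_max_left _ _) hXA')
  have main := sum_iSup_windowDisc_le ϑ hε hX hE hV hG₀ hfam
  -- T1 : the Type I terms
  have hT1 : (⌊X ^ ϑ⌋₊ : ℝ) * (4 * L * Ucut ε₁ X + 4 * (Ucut ε₁ X * Chebyshev.psi (Ucut ε₁ X))) ≤ X / L ^ A := by
    have hU0 : (0 : ℝ) ≤ Ucut ε₁ X := Nat.cast_nonneg _
    have hψ : Chebyshev.psi (Ucut ε₁ X) ≤ (Real.log 4 + 4) * Ucut ε₁ X := Chebyshev.psi_le_const_mul_self hU0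
    have hlog4 : Real.log 4 < 1.4 := by
      have := Real.log_two_lt_d9
      rw [show (4 : ℝ) = 2 ^ 2 by norm_num, Real.log_pow]; push_cast; linarith
    have hXε1 : 1 ≤ X ^ ε₁ := Real.one_le_rpow hX1 hε.le
    have hX2ε : X ^ ε₁ * X ^ ε₁ = X ^ (2 * ε₁) := by rw [← Real.rpow_add hX0]; ring_nf
    have hUU : (Ucut ε₁ X : ℝ) * Ucut ε₁ X ≤ X ^ (2 * ε₁) := by rw [← hX2ε]; exact mul_le_mul hUle hUle hU0 (by linarith)
    have hU2 : (Ucut ε₁ X : ℝ) ≤ X ^ (2 * ε₁) := by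
      rw [← hX2ε]; exact hUle.trans (le_mul_of_one_le_right (by linarith) hXε1)
    have hQ : (⌊X ^ ϑ⌋₊ : ℝ) ≤ X ^ ϑ := Nat.floor_le (Real.rpow_nonneg hX0.le _)
    have hin : 4 * L * Ucut ε₁ X + 4 * (Ucut ε₁ X * Chebyshev.psi (Ucut ε₁ X)) ≤ 26 * L * X ^ (2 * ε₁) := by
      have h1 : (Ucut ε₁ X : ℝ) * Chebyshev.psi (Ucut ε₁ X) ≤ 5.4 * X ^ (2 * ε₁) := by
        calc (Ucut ε₁ X : ℝ) * Chebyshev.psi (Ucut ε₁ X) ≤ Ucut ε₁ X * ((Real.log 4 + 4) * Ucut ε₁ X) :=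
              mul_le_mul_of_nonneg_left hψ hU0
          _ = (Real.log 4 + 4) * (Ucut ε₁ X * Ucut ε₁ X) := by ring
          _ ≤ 5.4 * X ^ (2 * ε₁) := mul_le_mul (by linarith) hUU (by positivity) (by norm_num)
      have h2 : 4 * L * Ucut ε₁ X ≤ 4 * L * X ^ (2 * ε₁) := mul_le_mul_of_nonneg_left hU2 (by positivity)
      have h3 : 0 ≤ X ^ (2 * ε₁) := by positivity
      have h4 : X ^ (2 * ε₁) ≤ L * X ^ (2 * ε₁) := le_mul_of_one_le_left h3 hL1
      linarith
    have hexp : X ^ ϑ * X ^ (2 * ε₁) = X ^ ((1 + ϑ) / 2) := by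
      rw [← Real.rpow_add hX0]; congr 1; rw [hε₁]; ring
    have hsplit : X = X ^ ((1 + ϑ) / 2) * X ^ ((1 - ϑ) / 2) := by
      rw [← Real.rpow_add hX0]; ring_nf; exact (Real.rpow_one X).symm
    have hLA1 : L ^ (A + 1) = L ^ A * L := by rw [Real.rpow_add hL0, Real.rpow_one]
    rw [le_div_iff₀ hLA]
    calc (⌊X ^ ϑ⌋₊ : ℝ) * (4 * L * Ucut ε₁ X + 4 * (Ucut ε₁ X * Chebyshev.psi (Ucut ε₁ X))) * L ^ A
        ≤ X ^ ϑ * (26 * L * X ^ (2 * ε₁)) * L ^ A := by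
          refine mul_le_mul_of_nonneg_right (mul_le_mul hQ hin (by positivity) (by positivity)) hLA.le
      _ = X ^ ((1 + ϑ) / 2) * (26 * L ^ (A + 1)) := by rw [hLA1, ← hexp]; ring
      _ ≤ X ^ ((1 + ϑ) / 2) * X ^ ((1 - ϑ) / 2) := mul_le_mul_of_nonneg_left hX1' (by positivity)
      _ = X := hsplit.symm
  -- T2 + T3 : the GEH terms
  have hT23 : 3 * ((Sidx B₀ X + 1 : ℕ) : ℝ) ^ 2 * (max C₀ 0 * (X / L ^ A')) ≤ 48 * max C₀ 0 * (X / L ^ A) := by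
    have hS := Sidx_succ_sq_le (X := X) hB₀0.le hL1 hX2'
    have hpow : L ^ A' = L ^ (2 * B₀ + 2) * L ^ A := by rw [hA', Real.rpow_add hL0]
    have hkey : ((Sidx B₀ X + 1 : ℕ) : ℝ) ^ 2 * (X / L ^ A') ≤ 16 * (X / L ^ A) := by
      have hP : 0 < L ^ (2 * B₀ + 2) := Real.rpow_pos_of_pos hL0 _
      have e : X / L ^ A' = (X / L ^ A) / L ^ (2 * B₀ + 2) := by
        rw [hpow, div_div, mul_comm]
      rw [e, ← mul_div_assoc, div_le_iff₀ hP]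
      calc ((Sidx B₀ X + 1 : ℕ) : ℝ) ^ 2 * (X / L ^ A) ≤ 16 * L ^ (2 * B₀ + 2) * (X / L ^ A) :=
            mul_le_mul_of_nonneg_right hS (by positivity)
        _ = 16 * (X / L ^ A) * L ^ (2 * B₀ + 2) := by ring
    calc 3 * ((Sidx B₀ X + 1 : ℕ) : ℝ) ^ 2 * (max C₀ 0 * (X / L ^ A'))
        = 3 * max C₀ 0 * (((Sidx B₀ X + 1 : ℕ) : ℝ) ^ 2 * (X / L ^ A')) := by ring
      _ ≤ 3 * max C₀ 0 * (16 * (X / L ^ A)) := mul_le_mul_of_nonneg_left hkey (by positivity)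
      _ = _ := by ring
  -- T4 : the straddle term
  have hT4 : 4 * (1 + Real.log ⌊X ^ ϑ⌋₊) ^ 2 *
      ∑ n ∈ straddleRange (rho B₀ X) ⌊X / 2⌋₊ ⌊X⌋₊, (σ 0 n : ℝ) * Real.log n ≤ X / L ^ A := by
    refine (straddle_term_le (B₀ := B₀) hϑ1.le hX).trans ?_
    have hδ : delta B₀ X ≤ 1 / L ^ B₀ := delta_le_inv_logpow B₀ X (Real.rpow_pos_of_pos hL0 _)
    have hB5 : L ^ B₀ = L ^ A * L ^ 5 := by
      rw [hB₀, Real.rpow_add hL0]; congr 1; exact_mod_cast Real.rpow_natCast L 5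
    have hA4 : L ^ (A + 4) = L ^ A * L ^ 4 := by
      rw [Real.rpow_add hL0]; congr 1; exact_mod_cast Real.rpow_natCast L 4
    have hA3 : L ^ (A + 3) = L ^ A * L ^ 3 := by
      rw [Real.rpow_add hL0]; congr 1; exact_mod_cast Real.rpow_natCast L 3
    rw [le_div_iff₀ hLA]
    -- first term: `2688 δ X L⁴ L^A = 2688 X (δ L^{B₀}) / L ≤ 2688 X / L ≤ X/3`
    have t1 : 2688 * delta B₀ X * X * L ^ 4 * L ^ A ≤ X / 3 := by
      have h1 : delta B₀ X * L ^ B₀ ≤ 1 := by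
        calc delta B₀ X * L ^ B₀ ≤ 1 / L ^ B₀ * L ^ B₀ :=
              mul_le_mul_of_nonneg_right hδ (Real.rpow_nonneg hL0.le _)
          _ = 1 := by field_simp
      have h2 : delta B₀ X * (L ^ A * L ^ 4) ≤ 1 / L := by
        rw [le_div_iff₀ hL0]
        calc delta B₀ X * (L ^ A * L ^ 4) * L = delta B₀ X * L ^ B₀ := by rw [hB5]; ring
          _ ≤ 1 := h1
      have h3 := mul_le_mul_of_nonneg_left hX3' hX0.le
      calc 2688 * delta B₀ X * X * L ^ 4 * L ^ A = 2688 * X * (delta B₀ X * (L ^ A * L ^ 4)) := by ring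
        _ ≤ 2688 * X * (1 / L) := mul_le_mul_of_nonneg_left h2 (by positivity)
        _ ≤ X / 3 := by
            rw [mul_one_div, div_le_div_iff₀ hL0 (by norm_num)]
            linarith
    -- second term
    have t2 : 384 * L ^ 4 * L ^ A ≤ X / 3 := by
      rw [hA4] at hX4'
      have e : 384 * L ^ 4 * L ^ A = 1152 * (L ^ A * L ^ 4) / 3 := by ring
      rw [e]
      exact div_le_div_of_nonneg_right hX4' (by norm_num)
    -- third term
    have t3 : 256 * L ^ 3 * Real.sqrt X * L ^ A ≤ X / 3 := by
      rw [hA3] at hX5'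
      have hs : Real.sqrt X * Real.sqrt X = X := Real.mul_self_sqrt hX0.le
      have hs0 : 0 ≤ Real.sqrt X := Real.sqrt_nonneg X
      have h1 := mul_le_mul_of_nonneg_right hX5' hs0
      rw [hs] at h1
      have e : 256 * L ^ 3 * Real.sqrt X * L ^ A = 768 * (L ^ A * L ^ 3) * Real.sqrt X / 3 := by ring
      rw [e]
      exact div_le_div_of_nonneg_right h1 (by norm_num)
    have e : (2688 * delta B₀ X * X * Real.log X ^ 4 + 384 * Real.log X ^ 4 +
        256 * Real.log X ^ 3 * Real.sqrt X) * L ^ A =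
        2688 * delta B₀ X * X * L ^ 4 * L ^ A + 384 * L ^ 4 * L ^ A + 256 * L ^ 3 * Real.sqrt X * L ^ A := by
      rw [hLdef]; ring
    rw [e]
    linarith
  -- assemble
  have hfinal := main.trans (add_le_add (add_le_add hT1 hT23) hT4)
  have e : X / L ^ A + 48 * max C₀ 0 * (X / L ^ A) + X / L ^ A = (2 + 48 * max C₀ 0) * X / L ^ A := by ring
  rw [e] at hfinal
  exact hfinal

end GEHtoEH

end Literature.NumberTheory.Sieve
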